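import Literature.Probability.RandomPlanarGeometry.DiscDomain
import Literature.Probability.RandomPlanarGeometry.PolylineArc
import Literature.Probability.RandomPlanarGeometry.LSW2004UST
import HarnessLib

/-!
# The disc approximations `D^m` satisfy `IsApproximation 𝔻 m D^m`; `hasSLETrace_eight` from the LSW facts

Conclusion of the construction of grid approximations of the unit disc for [LSW04] §4.3
(`Staircase`, `DiscPaths`, `DiscCycle`, `DiscDomain`): for `m ≥ 12` the lattice domain
`discDomain m` approximates `(m𝔻, mα_𝔻, mβ_𝔻)` in the sense of `USTPeano.IsApproximation` —
`ρ(α^m, m·arcA) ≤ 10`, `ρ(β^m, m·arcB) ≤ 10` for the tree's reparametrisation distance `ρ`, and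
`0 ∈ D^m`. The two bounds are instances of `reparamDist_pathCurve_circleArcCurve_le`
(`PolylineArc.lean`): the primal staircase, seen counterclockwise from `0` with all its points at
distance in `[m - 1, m + 2]` from `0`, runs from the direction `0` to the direction `π`, so it is
within `2` of the upper half circle of radius `m`; the dual staircase is handled through complex
conjugation (which preserves `ρ` and maps it to a counterclockwise polyline in the upper
half-plane), with end directions `πθ₀`, `π(1 - θ₀)`, `θ₀ ≤ 1/(π(2m-1))`, renormalised to `0`, `π`
at a cost `≤ 2mπθ₀ ≤ 2m/(2m-1)` (`dist_circleArcCurve_circleArcCurve_le`).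

* `pathCurve_one`, `pathCurve_map_conj`, `Curve.reparamDist_eq_of_conj`, `cross_conj`;
* `unitDisc_arcA_apply`, `unitDisc_arcB_apply` (`arcA t = e^{iπt}`, `arcB t = e^{-iπt}`);
* `reparamDist_alpha_le`, `reparamDist_beta_le`, `isApproximation_discDomain`;
* **`hasSLETrace_eight_of_LSW_facts`** — `hasSLETrace_eight` (SLE₈ is generated by a curve,
  [LSW04] Thm. 4.7) from the inputs of `LSW2004UST.lean` ALONE (§4.1, §2.1, Prop. 4.5 as the
  explicit hypothesis `h45`, Thm. 4.4 as used on p. 981): the family `discDomain (n + 12)` at the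
  scales `R_n = n + 12 → ∞` discharges the approximation hypothesis of `hasSLETrace_eight_of_LSW`.
-/

noncomputable section

open Set Function Complex Real Filter
open scoped unitInterval NNReal
open UpperHalfPlane (upperHalfPlaneSet)

namespace Literature.Probability.RandomPlanarGeometry

namespace USTPeano

open Curve

variable {m : ℕ}

/-! ### Generalities on polylines: the endpoint, conjugation -/

/-- A polyline ends at the last point. [folklore] -/
theorem pathCurve_one {L : List ℂ} (hL : L ≠ []) : pathCurve L 1 = L.getLast hL := by
  have h1 : 1 ≤ L.length := List.length_pos_iff.2 hL
  rw [pathCurve_apply, Set.Icc.coe_one, mul_one,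
    show (L.length : ℝ) - 1 = ((L.length - 1 : ℕ) : ℝ) by rw [Nat.cast_sub h1, Nat.cast_one],
    affineInterp_natCast L (L.length - 1) (by omega), List.getLast_eq_getElem]

/-- Affine interpolation commutes with complex conjugation. [folklore] -/
theorem affineInterp_map_conj : ∀ (L : List ℂ) (s : ℝ),
    affineInterp (L.map (starRingEnd ℂ)) s = starRingEnd ℂ (affineInterp L s)
  | [], s => by simp [affineInterp]
  | [a], s => by simp [affineInterp]
  | a :: b :: l, s => by
    simp only [List.map_cons]
    rw [affineInterp_cons_cons, affineInterp_cons_cons]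
    split_ifs with h
    · simp only [AffineMap.lineMap_apply_module', Complex.real_smul, map_add, map_mul,
        Complex.conj_ofReal, map_sub]
    · have := affineInterp_map_conj (b :: l) (s - 1)
      simpa using this

/-- A polyline through conjugated points is the conjugate polyline. [folklore] -/
theorem pathCurve_map_conj (L : List ℂ) (t : I) :
    pathCurve (L.map (starRingEnd ℂ)) t = starRingEnd ℂ (pathCurve L t) := by
  rw [pathCurve_apply, pathCurve_apply, List.length_map, affineInterp_map_conj]

/-- **The reparametrisation distance is invariant under conjugating both curves.** [folklore] -/
theorem _root_.Literature.Probability.RandomPlanarGeometry.Curve.reparamDist_eq_of_conj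
    {γ₁ γ₂ γ₁' γ₂' : Curve ℂ} (h₁ : ∀ t, γ₁' t = starRingEnd ℂ (γ₁ t))
    (h₂ : ∀ t, γ₂' t = starRingEnd ℂ (γ₂ t)) : reparamDist γ₁' γ₂' = reparamDist γ₁ γ₂ := by
  unfold reparamDist
  refine iInf_congr fun φ ↦ ?_
  have key : ∀ (f g f' g' : C(I, ℂ)), (∀ t, dist (f t) (g t) = dist (f' t) (g' t)) →
      dist f g ≤ dist f' g' := fun f g f' g' h ↦
    (ContinuousMap.dist_le dist_nonneg).2 fun t ↦ (h t).le.trans (ContinuousMap.dist_apply_le_dist t)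
  refine le_antisymm (key _ _ _ _ fun t ↦ ?_) (key _ _ _ _ fun t ↦ ?_)
  · change dist (γ₁' t) (γ₂' (φ t)) = dist (γ₁ t) (γ₂ (φ t))
    rw [h₁, h₂, Complex.dist_conj_conj]
  · change dist (γ₁ t) (γ₂ (φ t)) = dist (γ₁' t) (γ₂' (φ t))
    rw [h₁, h₂, Complex.dist_conj_conj]

/-- Conjugation reverses orientation: `cross (conj u) (conj v) = - cross u v`. [folklore] -/
theorem cross_conj (u v : ℂ) : cross (starRingEnd ℂ u) (starRingEnd ℂ v) = -cross u v := by
  simp [cross]; ring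

/-! ### The arcs of the unit disc -/

/-- `arcA` of the unit disc with `a = 1`, `b = -1` is the upper half circle `t ↦ e^{iπt}`. [folklore] -/
theorem unitDisc_arcA_apply (t : I) :
    SmoothDomain.unitDisc.arcA t = exp ((Real.pi * (t : ℝ) : ℝ) * Complex.I) := by
  rw [SmoothDomain.arcA_apply]
  change circleMap 0 1 (2 * Real.pi * (0 + (t : ℝ) * (1 / 2 - 0))) = _
  simp only [circleMap, ofReal_one, one_mul, zero_add]
  congr 1
  push_cast
  ring

/-- `arcB` of the unit disc is the lower half circle `t ↦ e^{-iπt}`. [folklore] -/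
theorem unitDisc_arcB_apply (t : I) :
    SmoothDomain.unitDisc.arcB t = exp (-((Real.pi * (t : ℝ) : ℝ) * Complex.I)) := by
  rw [SmoothDomain.arcB_apply]
  change circleMap 0 1 (2 * Real.pi * (0 + 1 - (t : ℝ) * (0 + 1 - 1 / 2))) = _
  simp only [circleMap, ofReal_one, one_mul, zero_add]
  have : ((2 * Real.pi * (1 - (t : ℝ) * (1 - 1 / 2)) : ℝ) : ℂ) * Complex.I =
      2 * Real.pi * Complex.I + -((Real.pi * (t : ℝ) : ℝ) * Complex.I) := by
    push_cast; ring
  rw [this, Complex.exp_add, Complex.exp_two_pi_mul_I, one_mul]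

/-- The target curve for `α`: `m · arcA = circleArcCurve m 0 1`. [folklore] -/
theorem scaleCurve_unitDisc_arcA (R : ℝ) :
    scaleCurve R SmoothDomain.unitDisc.arcA = circleArcCurve R 0 1 := by
  apply Curve.ext; apply ContinuousMap.ext; intro t
  change R * SmoothDomain.unitDisc.arcA t = circleArcCurve R 0 1 t
  rw [unitDisc_arcA_apply, circleArcCurve_apply]
  congr 2
  push_cast
  ring

/-- The conjugate of the target curve for `β` is the same arc: `conj (m · arcB t) =
circleArcCurve m 0 1 t`. [folklore] -/
theorem conj_scaleCurve_unitDisc_arcB (R : ℝ) (t : I) :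
    circleArcCurve R 0 1 t = starRingEnd ℂ (scaleCurve R SmoothDomain.unitDisc.arcB t) := by
  rw [scaleCurve_apply, unitDisc_arcB_apply, circleArcCurve_apply, map_mul, Complex.conj_ofReal,
    ← Complex.exp_conj]
  congr 2
  simp only [map_neg, map_mul, Complex.conj_ofReal, Complex.conj_I, mul_neg, neg_neg]
  push_cast
  ring

/-! ### The wired path `α^m` against the upper half circle -/

/-- The points of `α^m` as complex numbers. [folklore] -/
abbrev alphaPts (m : ℕ) : List ℂ := (alphaPath m).map primalPt

/-- Hypotheses of `ArgMonotone` / `PolylineArc` for `α^m` (`m ≥ 2`). [folklore] -/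
theorem alphaPts_hyps (hm : 2 ≤ m) :
    2 ≤ (alphaPts m).length ∧ (∀ p ∈ alphaPts m, 0 ≤ p.im) ∧
      (alphaPts m).IsChain (fun p q ↦ 0 < cross p q) ∧
      (alphaPts m).IsChain (fun p _ ↦ 0 < p.im ∨ 0 < p.re) ∧
      (∀ p ∈ alphaPts m, (m : ℝ) ≤ ‖p‖) ∧ (∀ p ∈ alphaPts m, ‖p‖ ≤ (m : ℝ) + 2) ∧
      (alphaPts m).IsChain (fun p q ↦ ‖q - p‖ ≤ 1) := by
  have hmr : (2 : ℝ) ≤ m := by exact_mod_cast hm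
  refine ⟨by simp [length_alphaPath]; omega, ?_, ?_, ?_, ?_, ?_, ?_⟩
  · intro p hp
    obtain ⟨v, hv, rfl⟩ := List.mem_map.1 hp
    have := (mem_alphaPath_bounds hv).2.2.1
    simp only [primalPt_im]; exact_mod_cast this
  · rw [List.isChain_map]
    refine (isChain_cross_alphaPath hm).imp fun p q h ↦ ?_
    rw [cross_primalPt]; exact_mod_cast h
  · rw [List.isChain_map]
    refine (isChain_aStep_alphaPath hm).imp fun p q h ↦ ?_
    simp only [primalPt_im, primalPt_re]
    rcases h with ⟨h, h1, h2⟩ | ⟨h, h1, h2⟩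
    · rcases h with ⟨-, hx⟩ | ⟨-, hy⟩
      · right; exact_mod_cast (show (0 : ℤ) < p.1 by omega)
      · left; exact_mod_cast (show (0 : ℤ) < p.2 by omega)
    · rcases h with ⟨he, -⟩ | ⟨he, hy⟩
      · have : p.2 = q.2 + 1 := by
          have := congrArg Prod.snd he; simp [mirrorP] at this; linarith
        left; exact_mod_cast (show (0 : ℤ) < p.2 by omega)
      · have : p.2 = q.2 := by
          have := congrArg Prod.snd he; simp [mirrorP] at this; linarith
        simp [mirrorP] at hy
        left; exact_mod_cast (show (0 : ℤ) < p.2 by omega)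
  · intro p hp
    obtain ⟨v, hv, rfl⟩ := List.mem_map.1 hp
    have hb := (mem_alphaPath_bounds hv).2.2.2.2.1
    refine le_norm_of_sq_le_normSq (by positivity) ?_
    rw [normSq_primalPt]
    exact_mod_cast hb
  · intro p hp
    obtain ⟨v, hv, rfl⟩ := List.mem_map.1 hp
    have hb := (mem_alphaPath_bounds hv).2.2.2.2.2
    have hb' : ((v.1 ^ 2 + v.2 ^ 2 : ℤ) : ℝ) < (((m : ℤ) + 2) ^ 2 : ℤ) := by exact_mod_cast hb
    rw [Complex.norm_def, ← Real.sqrt_sq (by linarith : (0 : ℝ) ≤ m + 2), normSq_primalPt]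
    exact Real.sqrt_le_sqrt (by push_cast at hb' ⊢; exact hb'.le)
  · rw [List.isChain_map]
    refine (isChain_latticeAdj_alphaPath hm).imp fun p q h ↦ ?_
    rw [← dist_eq_norm, dist_comm, dist_primalPt_of_latticeAdj h]

/-- The end directions of `α^m`: `arg (c 0) = 0` (at `(m, 0)`) and `arg (c 1) = π` (at `(-m, 0)`).
[folklore] -/
theorem angleFun_alphaPts (hm : 2 ≤ m) : angleFun (alphaPts m) 0 = 0 ∧ angleFun (alphaPts m) 1 = 1 := by
  have hmr : (0 : ℝ) < m := by exact_mod_cast (show 0 < m by omega)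
  have hne : alphaPts m ≠ [] := by simp [alphaPath_ne_nil]
  constructor
  · have e : angleFun (alphaPts m) 0 = arg (pathCurve (alphaPts m) 0) / Real.pi := angleFun_coe _ 0
    rw [e]
    have h0 : pathCurve (alphaPts m) 0 = ((m : ℝ) : ℂ) := by
      obtain ⟨x, l, hl⟩ := List.exists_cons_of_ne_nil (alphaPath_ne_nil m)
      have hx : x = ((m : ℤ), 0) := by
        have h := List.head?_eq_some_head (alphaPath_ne_nil m)
        rw [head_alphaPath (by omega), hl] at h
        simp at h
        exact h
      change pathCurve ((alphaPath m).map primalPt) 0 = _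
      rw [hl, List.map_cons, pathCurve_zero, hx]
      apply Complex.ext <;> simp
    rw [h0, Complex.arg_ofReal_of_nonneg hmr.le, zero_div]
  · have e : angleFun (alphaPts m) 1 = arg (pathCurve (alphaPts m) 1) / Real.pi := angleFun_coe _ 1
    rw [e, pathCurve_one hne]
    have h1 : (alphaPts m).getLast hne = ((-(m : ℝ) : ℝ) : ℂ) := by
      change ((alphaPath m).map primalPt).getLast _ = _
      rw [List.getLast_map, getLast_alphaPath hm]
      apply Complex.ext <;> simp
    rw [h1, Complex.arg_ofReal_of_neg (by linarith), div_self Real.pi_pos.ne']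

/-- **`ρ(α^m, m · arcA) ≤ 2`** (`m ≥ 2`). [folklore] -/
theorem reparamDist_alpha_le (hm : 2 ≤ m) :
    reparamDist (pathCurve (alphaPts m)) (scaleCurve m SmoothDomain.unitDisc.arcA) ≤ 2 := by
  obtain ⟨hL, him, hc, hslit, hr, hR, hstep⟩ := alphaPts_hyps hm
  obtain ⟨h0, h1⟩ := angleFun_alphaPts hm
  rw [scaleCurve_unitDisc_arcA, ← h0, ← h1]
  refine reparamDist_pathCurve_circleArcCurve_le hL him hc hslit zero_le_two fun t ↦ ?_
  obtain ⟨h1, h2⟩ := norm_pathCurve_mem hL hr hR hstep t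
  constructor <;> linarith

/-! ### The free path `β^m` against the lower half circle, through conjugation -/

/-- The conjugates of the points of `β^m`. [folklore] -/
abbrev betaPtsConj (m : ℕ) : List ℂ := (betaPath m).map (fun v ↦ starRingEnd ℂ (dualPt v))

/-- Hypotheses of `ArgMonotone` / `PolylineArc` for the conjugated `β^m` (`m ≥ 3`). [folklore] -/
theorem betaPtsConj_hyps (hm : 3 ≤ m) :
    2 ≤ (betaPtsConj m).length ∧ (∀ p ∈ betaPtsConj m, 0 ≤ p.im) ∧
      (betaPtsConj m).IsChain (fun p q ↦ 0 < cross p q) ∧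
      (betaPtsConj m).IsChain (fun p _ ↦ 0 < p.im ∨ 0 < p.re) ∧
      (∀ p ∈ betaPtsConj m, (m : ℝ) - 1 / 2 ≤ ‖p‖) ∧ (∀ p ∈ betaPtsConj m, ‖p‖ ≤ (m : ℝ) + 3) ∧
      (betaPtsConj m).IsChain (fun p q ↦ ‖q - p‖ ≤ 1) := by
  have hmr : (3 : ℝ) ≤ m := by exact_mod_cast hm
  have him : ∀ p ∈ betaPtsConj m, 1 / 2 ≤ p.im := by
    intro p hp
    obtain ⟨v, hv, rfl⟩ := List.mem_map.1 hp
    have := (mem_betaPath_bounds (by omega) hv).2.2.2.1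
    have h' : ((v.2 : ℤ) : ℝ) ≤ -1 := by exact_mod_cast this
    simp only [Complex.conj_im, dualPt_im]
    linarith
  refine ⟨by simp [length_betaPath (show 1 ≤ m by omega)]; omega,
    fun p hp ↦ by linarith [him p hp], ?_, ?_, ?_, ?_, ?_⟩
  · rw [List.isChain_map]
    refine (isChain_bStep_betaPath hm).imp fun u v h ↦ ?_
    rw [cross_conj]
    have h4 := four_mul_cross_dualPt v u
    have h2 : (2 : ℝ) ≤ (((2 * v.1 + 1) * (2 * u.2 + 1) - (2 * v.2 + 1) * (2 * u.1 + 1) : ℤ) : ℝ) := by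
      exact_mod_cast h.2
    have hanti : cross (dualPt u) (dualPt v) = -cross (dualPt v) (dualPt u) := by simp [cross]; ring
    linarith
  · rw [List.isChain_iff_getElem]
    intro i hi
    left
    linarith [him _ (List.getElem_mem (by omega : i < (betaPtsConj m).length))]
  · intro p hp
    obtain ⟨v, hv, rfl⟩ := List.mem_map.1 hp
    have hb := (mem_betaPath_bounds (by omega) hv).2.2.2.2.1
    rw [Complex.norm_conj]
    refine le_norm_of_sq_le_normSq (by linarith) ?_
    have h4 := four_mul_normSq_dualPt v
    have : ((4 * (m : ℤ) ^ 2 - 4 * m + 2 : ℤ) : ℝ) ≤ (((2 * v.1 + 1) ^ 2 + (2 * v.2 + 1) ^ 2 : ℤ) : ℝ) := by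
      exact_mod_cast hb
    push_cast at this h4
    nlinarith
  · intro p hp
    obtain ⟨v, hv, rfl⟩ := List.mem_map.1 hp
    have hb := (mem_betaPath_bounds (by omega) hv).2.2.2.2.2
    rw [Complex.norm_conj, Complex.norm_def, ← Real.sqrt_sq (by linarith : (0 : ℝ) ≤ m + 3)]
    apply Real.sqrt_le_sqrt
    have h4 := four_mul_normSq_dualPt v
    have : (((2 * v.1 + 1) ^ 2 + (2 * v.2 + 1) ^ 2 : ℤ) : ℝ) < ((4 * ((m : ℤ) + 3) ^ 2 : ℤ) : ℝ) := by
      exact_mod_cast hb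
    push_cast at this h4
    nlinarith
  · rw [List.isChain_map]
    refine (isChain_latticeAdj_betaPath hm).imp fun u v h ↦ ?_
    rw [← map_sub, Complex.norm_conj, ← dist_eq_norm, dist_comm, dist_dualPt_of_latticeAdj h]

/-- The first conjugated dual point `w₀ = (m - ½) + i/2` and its argument
`0 ≤ arg w₀ ≤ 1/(2m - 1)`. [folklore] -/
theorem arg_conj_dualPt_head (hm : 1 ≤ m) :
    0 ≤ arg (starRingEnd ℂ (dualPt (dualNbr (aIdx m)))) ∧
      arg (starRingEnd ℂ (dualPt (dualNbr (aIdx m)))) ≤ 1 / (2 * m - 1) := by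
  have hmr : (1 : ℝ) ≤ m := by exact_mod_cast hm
  rw [dualPt_dualNbr_aIdx]
  have hw : starRingEnd ℂ (⟨(m : ℝ) - 1 / 2, -(1 / 2)⟩ : ℂ) = ⟨(m : ℝ) - 1 / 2, 1 / 2⟩ := by
    apply Complex.ext <;> simp
  rw [hw]
  refine ⟨Complex.arg_nonneg_iff.2 (by norm_num), (arg_le_im_div_re (by simp; linarith) (by norm_num)).trans ?_⟩
  rw [div_le_div_iff₀ (by simp; linarith) (by linarith)]
  simp; linarith

/-- The end directions of the conjugated `β^m`: `θ₀ = arg w₀ / π` and `θ₁ = 1 - θ₀`. [folklore] -/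
theorem angleFun_betaPtsConj (hm : 3 ≤ m) :
    angleFun (betaPtsConj m) 0 = arg (starRingEnd ℂ (dualPt (dualNbr (aIdx m)))) / Real.pi ∧
      angleFun (betaPtsConj m) 1 = 1 - arg (starRingEnd ℂ (dualPt (dualNbr (aIdx m)))) / Real.pi := by
  have hne : betaPtsConj m ≠ [] := by simp [betaPath_ne_nil]
  constructor
  · have e : angleFun (betaPtsConj m) 0 = arg (pathCurve (betaPtsConj m) 0) / Real.pi :=
      angleFun_coe _ 0
    rw [e]
    congr 2
    obtain ⟨x, l, hl⟩ := List.exists_cons_of_ne_nil (betaPath_ne_nil m)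
    have hx : x = dualNbr (aIdx m) := by
      have h := List.head?_eq_some_head (betaPath_ne_nil m)
      rw [head_betaPath (by omega), hl] at h
      rw [dualNbr_aIdx]
      simp at h
      exact h
    change pathCurve ((betaPath m).map _) 0 = _
    rw [hl, List.map_cons, pathCurve_zero, hx]
  · have e : angleFun (betaPtsConj m) 1 = arg (pathCurve (betaPtsConj m) 1) / Real.pi :=
      angleFun_coe _ 1
    rw [e, pathCurve_one hne]
    have h1 : (betaPtsConj m).getLast hne = -(⟨(m : ℝ) - 1 / 2, -(1 / 2)⟩ : ℂ) := by
      change ((betaPath m).map _).getLast _ = _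
      rw [List.getLast_map, getLast_betaPath hm, ← dualNbr_bIdx, dualPt_dualNbr_bIdx]
      apply Complex.ext
      · simp; ring
      · simp
    rw [h1, dualPt_dualNbr_aIdx]
    set w : ℂ := ⟨(m : ℝ) - 1 / 2, -(1 / 2)⟩
    have hwim : w.im < 0 := by simp [w]
    have hmr : (3 : ℝ) ≤ m := by exact_mod_cast hm
    rw [Complex.arg_neg_eq_arg_add_pi_of_im_neg hwim, Complex.arg_conj]
    have hwpi : arg w ≠ Real.pi := fun h ↦ by
      have := (Complex.arg_eq_pi_iff.1 h).2; simp [w] at this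
    rw [if_neg hwpi]
    field_simp
    ring

/-- **`ρ(β^m, m · arcB) ≤ 5`** (`m ≥ 12`): `3` from the annulus `[m - 3/2, m + 3]` containing the
dual polyline, plus `2m · arg w₀ ≤ 2m/(2m-1) ≤ 2` for renormalising the end directions. [folklore] -/
theorem reparamDist_beta_le (hm : 12 ≤ m) :
    reparamDist (pathCurve ((betaPath m).map dualPt)) (scaleCurve m SmoothDomain.unitDisc.arcB) ≤ 5 := by
  have hmr : (12 : ℝ) ≤ m := by exact_mod_cast hm
  obtain ⟨hL, him, hc, hslit, hr, hR, hstep⟩ := betaPtsConj_hyps (show 3 ≤ m by omega)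
  obtain ⟨h0, h1⟩ := angleFun_betaPtsConj (show 3 ≤ m by omega)
  obtain ⟨ha0, ha1⟩ := arg_conj_dualPt_head (show 1 ≤ m by omega)
  set θ := arg (starRingEnd ℂ (dualPt (dualNbr (aIdx m)))) with hθ
  -- conjugate both curves
  have hconj : reparamDist (pathCurve (betaPtsConj m)) (circleArcCurve m 0 1) =
      reparamDist (pathCurve ((betaPath m).map dualPt)) (scaleCurve m SmoothDomain.unitDisc.arcB) := by
    refine Curve.reparamDist_eq_of_conj (fun t ↦ ?_) (fun t ↦ conj_scaleCurve_unitDisc_arcB m t)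
    rw [← pathCurve_map_conj, List.map_map]
    rfl
  rw [← hconj]
  -- the conjugated polyline against the arc between its own end directions, then renormalise
  have hmain : reparamDist (pathCurve (betaPtsConj m))
      (circleArcCurve m (angleFun (betaPtsConj m) 0) (angleFun (betaPtsConj m) 1)) ≤ 3 := by
    refine reparamDist_pathCurve_circleArcCurve_le hL him hc hslit (by norm_num) fun t ↦ ?_
    obtain ⟨h1, h2⟩ := norm_pathCurve_mem hL hr hR hstep t
    constructor <;> linarith
  have hrenorm : dist (circleArcCurve m (angleFun (betaPtsConj m) 0) (angleFun (betaPtsConj m) 1)).toContinuousMap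
      (circleArcCurve m 0 1).toContinuousMap ≤ 2 := by
    refine (dist_circleArcCurve_circleArcCurve_le (by positivity) _ _ _ _).trans ?_
    rw [h0, h1, sub_zero, show 1 - θ / Real.pi - 1 = -(θ / Real.pi) by ring, abs_neg,
      abs_of_nonneg (div_nonneg ha0 Real.pi_pos.le)]
    have : (m : ℝ) * Real.pi * (θ / Real.pi + θ / Real.pi) = 2 * m * θ := by
      field_simp; ring
    rw [this]
    have h2m : (0 : ℝ) < 2 * m - 1 := by linarith
    calc 2 * (m : ℝ) * θ ≤ 2 * m * (1 / (2 * m - 1)) := by gcongr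
      _ ≤ 2 := by rw [mul_one_div, div_le_iff₀ h2m]; linarith
  calc reparamDist (pathCurve (betaPtsConj m)) (circleArcCurve m 0 1)
      ≤ reparamDist (pathCurve (betaPtsConj m))
          (circleArcCurve m (angleFun (betaPtsConj m) 0) (angleFun (betaPtsConj m) 1)) +
        reparamDist (circleArcCurve m (angleFun (betaPtsConj m) 0) (angleFun (betaPtsConj m) 1))
          (circleArcCurve m 0 1) := reparamDist_triangle _ _ _
    _ ≤ 3 + 2 := add_le_add hmain ((reparamDist_le_dist _ _).trans hrenorm)
    _ = 5 := by norm_num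

/-! ### The approximation property and the conclusion -/

/-- **`D^m` is a grid approximation of `(m𝔻, mα_𝔻, mβ_𝔻)`** in the sense of [LSW04] §4.3
(`USTPeano.IsApproximation`), for `m ≥ 12`. [cite: LawlerSchrammWerner2004, §4.3] -/
theorem isApproximation_discDomain (hm : 12 ≤ m) :
    IsApproximation SmoothDomain.unitDisc m (discDomain m hm) :=
  ⟨(reparamDist_alpha_le (show 2 ≤ m by omega)).trans (by norm_num),
    (reparamDist_beta_le hm).trans (by norm_num), zero_mem_discDomain hm⟩

/-- **[LSW04] Thm. 4.7 (SLE₈ is generated by a curve) from the inputs of `LSW2004UST.lean`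
alone.** The family `discDomain (n + 12)` of grid approximations of the unit disc at the scales
`R_n = n + 12 → ∞` discharges the approximation hypothesis of `hasSLETrace_eight_of_LSW`; what is
left of `Literature.Probability.RandomPlanarGeometry.hasSLETrace_eight` is exactly
`nonempty_peanoPath` (§4.1), `exists_capacityImage` (§2.1), **Prop. 4.5** (p. 977: "For every
`ε > 0` and `t̄ > 0` there are some positive `R₀ = R₀(D, t̄, ε)` and `δ = δ(D, t̄, ε)` such that
for all `R > R₀`, `P[sup{|γ̂(t₂) - γ̂(t₁)| : t₁, t₂ ∈ [0, t̄], |t₂ - t₁| ≤ δ} > ε] < ε`" — the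
explicit hypothesis `h45`, spelled out as in `hasSLETrace_eight_of_LSW`; an XL published estimate
used only here, hence part of the proof obligation of `hasSLETrace_eight` rather than a separate
named fact, D-0026) and `drivingProcess_tendsto` (Thm. 4.4 as used on p. 981).
[cite: LawlerSchrammWerner2004, Thm. 4.7] -/
theorem hasSLETrace_eight_of_LSW_facts (h41 : nonempty_peanoPath) (hcap : exists_capacityImage)
    (h45 : ∀ (D : SmoothDomain) (ε t : ℝ), 0 < ε → 0 < t →
      ∃ R₀ δ : ℝ, 0 < δ ∧ ∀ (R : ℝ) (Δ : Domain), R₀ < R → IsApproximation D R Δ →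
        ∀ (φ : ConformalEquiv upperHalfPlaneSet Δ.carrier), Δ.IsLSWMap φ →
          ∀ (Γ : PeanoPath Δ → C(ℝ≥0, ℂ)) (W : PeanoPath Δ → C(ℝ≥0, ℝ)),
            (∀ γ, IsCapacityImage Δ φ γ (Γ γ) (W γ)) →
              ustLaw Δ {γ | ∃ t₁ t₂ : ℝ≥0, (t₁ : ℝ) ≤ t ∧ (t₂ : ℝ) ≤ t ∧
                dist t₁ t₂ ≤ δ ∧ ε < dist (Γ γ t₁) (Γ γ t₂)} < ENNReal.ofReal ε)
    (h44 : drivingProcess_tendsto) : hasSLETrace_eight :=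
  hasSLETrace_eight_of_LSW SmoothDomain.unitDisc (fun n ↦ ((n + 12 : ℕ) : ℝ))
    (fun n ↦ discDomain (n + 12) (by omega))
    (tendsto_natCast_atTop_atTop.comp (tendsto_add_atTop_nat 12))
    (fun n ↦ isApproximation_discDomain (by omega)) h41 hcap h45 h44

end USTPeano

end Literature.Probability.RandomPlanarGeometry
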